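import Mathlib.LinearAlgebra.Matrix.GeneralLinearGroup.Defs
import Mathlib.LinearAlgebra.Matrix.SpecialLinearGroup
import Mathlib.LinearAlgebra.Matrix.ToLin
import Mathlib.LinearAlgebra.Semisimple
import Mathlib.Algebra.MvPolynomial.Monad
import Mathlib.Algebra.Group.Pi.Units
import Mathlib.RingTheory.Nilpotent.Defs
import Mathlib.GroupTheory.Index
import Mathlib.GroupTheory.Solvable
import Mathlib.FieldTheory.IsAlgClosed.Basic
import HarnessLib

-- provenance: harness21/H21/H21/Prelude/AutomorphicL/LinearAlgebraicGroups.lean @ 2842249 (interim HEAD d8f2665); M5 mechanical rewrite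
open scoped IsMulCommutative

/-!
# Linear algebraic groups as subgroups of `GL n k` (trunk T-AUTOMORPHIC, G25 AutomorphicL, item I1)

This file sets up the elementary vocabulary of linear algebraic groups needed to say
"the complex dual group `Ĝ ≤ GL_N(ℂ)` is connected reductive with a given based root datum"
(notion `dual_group_L_group`, OUTLINE D1/I1), in the most concrete possible form: an
"algebraic group" is a subgroup `G ≤ GL n k` of the general linear group over a field `k`
which is the zero locus of a set of polynomials in the matrix entries and `det⁻¹`.

## Main definitions (namespace `Literature.Automorphic`)

* `GLCoord n := (n × n) ⊕ Unit`, the index type of the affine coordinates of `GL n`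
  (entries `x i j` and `det⁻¹`), and `glCoordFun g : GLCoord n → k` the coordinates of `g`.
* `zeroLocusGL S`, `IsAlgebraicSubgroup G`: Zariski-closed subgroups of `GL n k`.
* `MonoidHom.IsAlgebraicGL`, `IsAlgebraicAddHom`, `IsAlgebraicCochar`, `IsAlgebraicChar`:
  homomorphisms whose coordinates are polynomial.
* `IsUnipotentElt`, `IsSemisimpleElt`, `IsUnipotentSubgroup`.
* `IsZConnected` (no proper closed subgroup of finite index), `IsTorusSubgroup`,
  `IsReductiveSubgroup`, `IsConnectedReductive`, `IsMaximalTorusIn`, `IsBorelIn`, `IsParabolicIn`.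
* `characterLattice T`, `cocharacterLattice T` and the pairing `charPairingInt χ λ : ℤ`
  (`⟨χ, λ⟩ = m` when `χ ∘ λ = (· ^ m)`).
* `diagonalGL`, `diagonalSubgroup n k`: the standard diagonal torus.

## Faithfulness caveat (OUTLINE D1)

Everything here is phrased in terms of the group of `k`-points `G ≤ GL_n(k)`:
"closed" means "zero locus inside `GL_n(k)`", "connected" means "no proper closed subgroup of
finite index among the `k`-points". This is the textbook notion (Springer, Borel, Humphreys work
over an algebraically closed field and identify a group with its points) **only when `k` is
algebraically closed**. All target statements consuming this file (lang.S13) assume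
`[IsAlgClosed k]`, and the dual group (item DualGroup) uses `k = ℂ`. Over a non-closed field the
predicates below are still well defined but are *not* the scheme-theoretic notions.

## Mathlib

Mathlib has `Matrix.GeneralLinearGroup`, `Matrix.SpecialLinearGroup`, `MvPolynomial.eval`,
`IsNilpotent`, `Module.End.IsSemisimple`, `Subgroup.FiniteIndex`, `IsSolvable`,
`IsMulCommutative`, `RootPairing` (used in item RootData), but no notion of (linear) algebraic
group, torus, Borel/parabolic subgroup or character lattice of an algebraic group; we searched for
`AlgebraicGroup`, `IsUnipotent`, `Borel` (only measure-theoretic), `characterLattice`. The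
commutative-subgroup mixin is `[IsMulCommutative ↥T]` with the scoped `CommGroup` instance
(`open scoped IsMulCommutative`, OUTLINE §0 H2).

## References

* T. A. Springer, *Linear Algebraic Groups* (2nd ed., 1998), §§2.1–2.4, 3.2, 6.2–6.4, 7.3–8.1.
* A. Borel, *Linear Algebraic Groups* (2nd ed., 1991), §§1.6, 4, 8, 11.
* J. E. Humphreys, *Linear Algebraic Groups* (1975), §§7, 15, 16, 19, 21.
-/

namespace Literature.NumberTheory.Automorphic

variable {k : Type*} [Field k] {n : Type*} [Fintype n] [DecidableEq n]

/-! ### Coordinates on `GL n` and Zariski-closed subgroups -/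

/-- The index type of the affine coordinate functions on `GL n`: a matrix entry `(i, j)` or the
extra coordinate `det⁻¹` (so that `GL n = {(x, y) | det x · y = 1}` is affine;
Springer, *Linear Algebraic Groups*, 2.1.4). [folklore] -/
abbrev GLCoord (n : Type*) : Type _ := (n × n) ⊕ Unit

/-- The coordinates of `g : GL n k`: `glCoordFun g (inl (i, j)) = g i j` and
`glCoordFun g (inr ()) = (det g)⁻¹` (Springer 2.1.4). [folklore] -/
def glCoordFun (g : GL n k) : GLCoord n → k
  | Sum.inl ij => (g : Matrix n n k) ij.1 ij.2
  | Sum.inr _ => (Matrix.det (g : Matrix n n k))⁻¹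

/-- The entry coordinates of `g` (Springer 2.1.4). [folklore] -/
@[simp] lemma glCoordFun_inl (g : GL n k) (i j : n) :
    glCoordFun g (Sum.inl (i, j)) = (g : Matrix n n k) i j := rfl

/-- The coordinate `det⁻¹` of `g` (Springer 2.1.4). [folklore] -/
@[simp] lemma glCoordFun_inr (g : GL n k) (u : Unit) :
    glCoordFun g (Sum.inr u) = (Matrix.det (g : Matrix n n k))⁻¹ := rfl

/-- A matrix in `GL n k` is determined by its coordinates (Springer 2.1.4). [folklore] -/
theorem glCoordFun_injective : Function.Injective (glCoordFun : GL n k → GLCoord n → k) := by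
  intro g h hgh
  refine Units.ext (Matrix.ext fun i j => ?_)
  simpa using congrFun hgh (Sum.inl (i, j))

/-- The zero locus in `GL n k` of a set `S` of polynomials in the coordinates `x i j, det⁻¹`
(Springer 1.1.2, 2.1.4). [folklore] -/
def zeroLocusGL (S : Set (MvPolynomial (GLCoord n) k)) : Set (GL n k) :=
  {g | ∀ p ∈ S, MvPolynomial.eval (glCoordFun g) p = 0}

/-- A subgroup `G ≤ GL n k` is *algebraic* (Zariski closed) if its underlying set is the zero
locus of some set of polynomials in the coordinates `x i j, det⁻¹` (Springer 2.1.1, 2.1.4;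
Borel 1.6). Over an algebraically closed field these are exactly the linear algebraic groups. [folklore] -/
def IsAlgebraicSubgroup (G : Subgroup (GL n k)) : Prop :=
  ∃ S : Set (MvPolynomial (GLCoord n) k), (G : Set (GL n k)) = zeroLocusGL S

/-- The whole group `GL n k` is algebraic (empty set of equations; Springer 2.1.4). [folklore] -/
theorem isAlgebraicSubgroup_top : IsAlgebraicSubgroup (⊤ : Subgroup (GL n k)) :=
  ⟨∅, by ext g; simp [zeroLocusGL]⟩

/-- The trivial subgroup of `GL n k` is algebraic, cut out by `x i j = δ i j`
(Springer 2.1.4). [folklore] -/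
theorem isAlgebraicSubgroup_bot : IsAlgebraicSubgroup (⊥ : Subgroup (GL n k)) := by
  refine ⟨Set.range fun ij : n × n =>
    MvPolynomial.X (Sum.inl ij) - MvPolynomial.C ((1 : Matrix n n k) ij.1 ij.2), ?_⟩
  ext g
  simp only [Subgroup.coe_bot, Set.mem_singleton_iff, zeroLocusGL, Set.mem_setOf_eq,
    Set.forall_mem_range, map_sub, MvPolynomial.eval_X, MvPolynomial.eval_C, sub_eq_zero,
    Prod.forall, glCoordFun_inl]
  constructor
  · rintro rfl i j; simp
  · intro h; exact Units.ext (Matrix.ext h)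

/-! ### Polynomiality of inversion and multiplication on `GL n` -/

/-- The generic matrix `(X (inl (i, j)))ᵢⱼ` over the coordinate ring of `GL n`. [folklore] -/
noncomputable def genericMatrixGL (n : Type*) (k : Type*) [Field k] :
    Matrix n n (MvPolynomial (GLCoord n) k) :=
  Matrix.of fun i j => MvPolynomial.X (Sum.inl (i, j))

/-- Evaluating the generic matrix at the coordinates of `g` gives `g`. [folklore] -/
lemma eval_mapMatrix_genericMatrixGL (g : GL n k) :
    (MvPolynomial.eval (glCoordFun g)).mapMatrix (genericMatrixGL n k) = (g : Matrix n n k) := by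
  ext i j; simp [genericMatrixGL]

/-- The polynomials expressing the coordinates of `g⁻¹` in terms of those of `g`:
`(g⁻¹) i j = det⁻¹ · adj(g) i j` and `det (g⁻¹)⁻¹ = det g` (Cramer; Springer 2.1.4: inversion is
a morphism `GL n → GL n`). [folklore] -/
noncomputable def invPolyGL : GLCoord n → MvPolynomial (GLCoord n) k
  | Sum.inl ij => MvPolynomial.X (Sum.inr ()) * (genericMatrixGL n k).adjugate ij.1 ij.2
  | Sum.inr _ => (genericMatrixGL n k).det

/-- The coordinates of `g⁻¹` are the polynomials `invPolyGL` evaluated at the coordinates of `g`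
(Springer 2.1.4). [folklore] -/
theorem eval_invPolyGL (g : GL n k) (c : GLCoord n) :
    MvPolynomial.eval (glCoordFun g) (invPolyGL c) = glCoordFun g⁻¹ c := by
  rcases c with ⟨i, j⟩ | u
  · have hadj := congrFun (congrFun
      (RingHom.map_adjugate (MvPolynomial.eval (glCoordFun g)) (genericMatrixGL n k)) i) j
    rw [eval_mapMatrix_genericMatrixGL, RingHom.mapMatrix_apply, Matrix.map_apply] at hadj
    simp only [invPolyGL, map_mul, MvPolynomial.eval_X, glCoordFun_inr, glCoordFun_inl,
      Matrix.coe_units_inv, hadj]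
    rw [Matrix.inv_def, Ring.inverse_eq_inv', Matrix.smul_apply, smul_eq_mul]
  · simp only [invPolyGL, glCoordFun_inr, Matrix.coe_units_inv, Matrix.det_nonsing_inv,
      Ring.inverse_eq_inv', inv_inv]
    rw [RingHom.map_det, eval_mapMatrix_genericMatrixGL]

/-- The polynomials (in two sets of coordinates) expressing the coordinates of a product `g * h`
(Springer 2.1.4: multiplication is a morphism). [folklore] -/
noncomputable def mulPolyGL : GLCoord n → MvPolynomial (GLCoord n ⊕ GLCoord n) k
  | Sum.inl ij => ∑ l : n, MvPolynomial.X (Sum.inl (Sum.inl (ij.1, l))) *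
      MvPolynomial.X (Sum.inr (Sum.inl (l, ij.2)))
  | Sum.inr _ => MvPolynomial.X (Sum.inl (Sum.inr ())) * MvPolynomial.X (Sum.inr (Sum.inr ()))

/-- The coordinates of `g * h` are the polynomials `mulPolyGL` evaluated at the coordinates of
`g` and `h` (Springer 2.1.4). [folklore] -/
theorem eval_mulPolyGL (g h : GL n k) (c : GLCoord n) :
    MvPolynomial.eval (Sum.elim (glCoordFun g) (glCoordFun h)) (mulPolyGL c) =
      glCoordFun (g * h) c := by
  rcases c with ⟨i, j⟩ | u
  · simp [mulPolyGL, Matrix.mul_apply]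
  · simp [mulPolyGL, Matrix.det_mul, mul_comm]

/-- `MvPolynomial.eval` commutes with substitution `bind₁` (specialisation of
`MvPolynomial.eval₂Hom_bind₁` to the identity ring map). [folklore] -/
lemma eval_bind₁ {σ τ : Type*} (x : τ → k) (h : σ → MvPolynomial τ k) (φ : MvPolynomial σ k) :
    MvPolynomial.eval x (MvPolynomial.bind₁ h φ) =
      MvPolynomial.eval (fun i => MvPolynomial.eval x (h i)) φ :=
  MvPolynomial.eval₂Hom_bind₁ _ _ _ _

/-! ### Algebraic homomorphisms -/

variable {m : Type*} [Fintype m] [DecidableEq m]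

/-- A homomorphism `f : G → GL m k` from a subgroup `G ≤ GL n k` is *algebraic* (a morphism of
linear algebraic groups) if every coordinate of `f g` is a polynomial in the coordinates of `g`
(Springer 2.1.1, 2.2.1). Declared as `Literature.NumberTheory.Automorphic.MonoidHom.IsAlgebraicGL` so that dot
notation `f.IsAlgebraicGL` is available once the namespace is open. [folklore] -/
def MonoidHom.IsAlgebraicGL {G : Subgroup (GL n k)} (f : ↥G →* GL m k) : Prop :=
  ∃ P : GLCoord m → MvPolynomial (GLCoord n) k,
    ∀ (g : ↥G) (c : GLCoord m), glCoordFun (f g) c = MvPolynomial.eval (glCoordFun (g : GL n k)) (P c)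

/-- A homomorphism `u : 𝔾ₐ = (k, +) → G ≤ GL n k` is *algebraic* if every coordinate of `u x` is a
polynomial in `x` (Springer 2.1.1, 3.4.1; used for root homomorphisms, Springer 8.1.1). [folklore] -/
def IsAlgebraicAddHom {G : Subgroup (GL n k)} (u : Multiplicative k →* ↥G) : Prop :=
  ∃ P : GLCoord n → Polynomial k,
    ∀ (x : k) (c : GLCoord n),
      glCoordFun ((u (Multiplicative.ofAdd x) : ↥G) : GL n k) c = (P c).eval x

/-- A homomorphism `λ : 𝔾ₘ = kˣ → G ≤ GL n k` (a *cocharacter*) is *algebraic* if every coordinate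
of `λ x` is a polynomial in `x` and `x⁻¹`, i.e. a Laurent polynomial in `x`; we encode Laurent
polynomials as `MvPolynomial (Fin 2) k` evaluated at `![x, x⁻¹]` (Springer 3.2.1). [folklore] -/
def IsAlgebraicCochar {G : Subgroup (GL n k)} (γ : kˣ →* ↥G) : Prop :=
  ∃ P : GLCoord n → MvPolynomial (Fin 2) k,
    ∀ (x : kˣ) (c : GLCoord n),
      glCoordFun ((γ x : ↥G) : GL n k) c = MvPolynomial.eval ![(x : k), (x⁻¹ : kˣ)] (P c)

/-- A homomorphism `χ : T → 𝔾ₘ = kˣ` from a subgroup `T ≤ GL n k` (a *character*) is *algebraic*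
if `χ t` is a polynomial in the coordinates of `t` (Springer 3.2.1; then so is
`(χ t)⁻¹ = χ t⁻¹`, see `IsAlgebraicChar.inv`). [folklore] -/
def IsAlgebraicChar {T : Subgroup (GL n k)} (χ : ↥T →* kˣ) : Prop :=
  ∃ p : MvPolynomial (GLCoord n) k,
    ∀ t : ↥T, ((χ t : kˣ) : k) = MvPolynomial.eval (glCoordFun (t : GL n k)) p

/-! ### Jordan decomposition vocabulary -/

/-- `g ∈ GL n k` is *unipotent* if `g - 1` is nilpotent (Springer 2.4.5, Humphreys §15.1). [folklore] -/
def IsUnipotentElt (g : GL n k) : Prop :=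
  IsNilpotent ((g : Matrix n n k) - 1)

/-- `g ∈ GL n k` is *semisimple* if the endomorphism of `kⁿ` it defines is semisimple (every
invariant subspace has an invariant complement; over an algebraically closed field: diagonalisable)
(Springer 2.4.1, 2.4.5; Mathlib `Module.End.IsSemisimple`). [folklore] -/
def IsSemisimpleElt (g : GL n k) : Prop :=
  Module.End.IsSemisimple (Matrix.toLin' (g : Matrix n n k))

/-- The identity is unipotent. [folklore] -/
theorem IsUnipotentElt.one : IsUnipotentElt (1 : GL n k) := by
  simp [IsUnipotentElt]

/-- A subgroup `U ≤ GL n k` is *unipotent* if all its elements are (Springer 2.4.11). [folklore] -/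
def IsUnipotentSubgroup (U : Subgroup (GL n k)) : Prop :=
  ∀ u ∈ U, IsUnipotentElt u

/-! ### Connectedness, tori, reductive, Borel and parabolic subgroups -/

/-- A subgroup `G ≤ GL n k` is *Zariski-connected* if it is algebraic and has no proper algebraic
subgroup of finite index (Springer 2.2.1: for a linear algebraic group the identity component
`G°` is the unique closed subgroup of finite index that is connected, and closed subgroups of
finite index contain `G°`; Humphreys 7.3). Faithful to the textbook notion for `k` algebraically
closed (see the module docstring). [folklore] -/
def IsZConnected (G : Subgroup (GL n k)) : Prop :=
  IsAlgebraicSubgroup G ∧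
    ∀ H : Subgroup (GL n k), H ≤ G → IsAlgebraicSubgroup H → (H.subgroupOf G).FiniteIndex → H = G

/-- A subgroup `T ≤ GL n k` is a *torus* if it is Zariski-connected, commutative and consists of
semisimple elements (Springer 3.2.1 with 2.4.2 (ii)/3.2.7: over an algebraically closed field a
connected closed subgroup of `GL n` is a torus iff it is commutative and consists of semisimple
elements, iff it is conjugate into the diagonal matrices). [folklore] -/
def IsTorusSubgroup (T : Subgroup (GL n k)) : Prop :=
  IsZConnected T ∧ IsMulCommutative ↥T ∧ ∀ t ∈ T, IsSemisimpleElt t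

/-- A subgroup `G ≤ GL n k` is *reductive* if it is algebraic and its unipotent radical is trivial,
i.e. it has no non-trivial Zariski-connected unipotent subgroup that is normal in `G`
(Springer 6.4.14, 7.3.1; Borel 11.21; Humphreys 19.5). [folklore] -/
def IsReductiveSubgroup (G : Subgroup (GL n k)) : Prop :=
  IsAlgebraicSubgroup G ∧
    ∀ U : Subgroup (GL n k), U ≤ G → (U.subgroupOf G).Normal → IsZConnected U →
      IsUnipotentSubgroup U → U = ⊥

/-- A *connected reductive* subgroup of `GL n k`: Zariski-connected and reductive
(Springer 7.3.1). [folklore] -/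
def IsConnectedReductive (G : Subgroup (GL n k)) : Prop :=
  IsZConnected G ∧ IsReductiveSubgroup G

/-- `T` is a *maximal torus* of `G ≤ GL n k`: a torus contained in `G` and maximal among such
(Springer 6.3.4, 6.4.1). [folklore] -/
def IsMaximalTorusIn (T G : Subgroup (GL n k)) : Prop :=
  T ≤ G ∧ IsTorusSubgroup T ∧
    ∀ T' : Subgroup (GL n k), T ≤ T' → T' ≤ G → IsTorusSubgroup T' → T' = T

/-- `B` is a *Borel subgroup* of `G ≤ GL n k`: a Zariski-connected solvable algebraic subgroup of
`G`, maximal among such (Springer 6.2.1, Humphreys 21.3). [folklore] -/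
def IsBorelIn (B G : Subgroup (GL n k)) : Prop :=
  B ≤ G ∧ IsZConnected B ∧ IsSolvable ↥B ∧
    ∀ B' : Subgroup (GL n k), B ≤ B' → B' ≤ G → IsZConnected B' → IsSolvable ↥B' → B' = B

/-- `P` is a *parabolic subgroup* of `G ≤ GL n k`: an algebraic subgroup of `G` containing a
Borel subgroup of `G` (Springer 6.2.7 with 6.2.1; equivalently `G/P` is complete). [folklore] -/
def IsParabolicIn (P G : Subgroup (GL n k)) : Prop :=
  P ≤ G ∧ IsAlgebraicSubgroup P ∧ ∃ B : Subgroup (GL n k), IsBorelIn B G ∧ B ≤ P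

/-! ### Character and cocharacter lattices -/

section Lattices

variable {T : Subgroup (GL n k)}

/-- The trivial character is algebraic. [folklore] -/
lemma IsAlgebraicChar.one : IsAlgebraicChar (1 : ↥T →* kˣ) :=
  ⟨1, fun t => by simp⟩

/-- A product of algebraic characters is algebraic. [folklore] -/
lemma IsAlgebraicChar.mul {χ ψ : ↥T →* kˣ} (hχ : IsAlgebraicChar χ) (hψ : IsAlgebraicChar ψ) :
    IsAlgebraicChar (χ * ψ) := by
  obtain ⟨p, hp⟩ := hχ
  obtain ⟨q, hq⟩ := hψ
  exact ⟨p * q, fun t => by simp [hp, hq]⟩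

/-- The inverse of an algebraic character is algebraic (`(χ t)⁻¹ = χ t⁻¹` and inversion on `GL n`
is polynomial, `eval_invPolyGL`). [folklore] -/
lemma IsAlgebraicChar.inv {χ : ↥T →* kˣ} (hχ : IsAlgebraicChar χ) : IsAlgebraicChar χ⁻¹ := by
  obtain ⟨p, hp⟩ := hχ
  refine ⟨MvPolynomial.bind₁ invPolyGL p, fun t => ?_⟩
  rw [eval_bind₁]
  simp only [MonoidHom.inv_apply, ← map_inv, hp, Subgroup.coe_inv, eval_invPolyGL]

variable (T) in
/-- The *character lattice* `X*(T)` of a subgroup `T ≤ GL n k`: the group of algebraic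
homomorphisms `T → 𝔾ₘ` (Springer 3.2.1; for a torus over an algebraically closed field this is a
free abelian group of rank `dim T`, Springer 3.2.7). Written multiplicatively as a subgroup of
`↥T →* kˣ`; item RootData passes to `Additive`. [folklore] -/
def characterLattice : Subgroup (↥T →* kˣ) where
  carrier := {χ | IsAlgebraicChar χ}
  one_mem' := IsAlgebraicChar.one
  mul_mem' := IsAlgebraicChar.mul
  inv_mem' := IsAlgebraicChar.inv

/-- Membership in the character lattice (Springer 3.2.1). [folklore] -/
@[simp] lemma mem_characterLattice_iff (χ : ↥T →* kˣ) :
    χ ∈ characterLattice T ↔ IsAlgebraicChar χ := Iff.rfl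

/-- The trivial cocharacter is algebraic. [folklore] -/
lemma IsAlgebraicCochar.one : IsAlgebraicCochar (1 : kˣ →* ↥T) :=
  ⟨fun c => MvPolynomial.C (glCoordFun (1 : GL n k) c), fun x c => by simp⟩

variable [IsMulCommutative ↥T]

/-- A product of algebraic cocharacters of a commutative `T` is algebraic (multiplication on
`GL n` is polynomial, `eval_mulPolyGL`). [folklore] -/
lemma IsAlgebraicCochar.mul {γ μ : kˣ →* ↥T} (hγ : IsAlgebraicCochar γ) (hμ : IsAlgebraicCochar μ) :
    IsAlgebraicCochar (γ * μ) := by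
  obtain ⟨P, hP⟩ := hγ
  obtain ⟨Q, hQ⟩ := hμ
  refine ⟨fun c => MvPolynomial.bind₁ (Sum.elim P Q) (mulPolyGL c), fun x c => ?_⟩
  have h : Sum.elim (glCoordFun ((γ x : ↥T) : GL n k)) (glCoordFun ((μ x : ↥T) : GL n k)) =
      fun i => MvPolynomial.eval ![(x : k), (x⁻¹ : kˣ)] (Sum.elim P Q i) := by
    funext d; rcases d with d | d <;> simp [hP, hQ]
  rw [eval_bind₁, MonoidHom.mul_apply, Subgroup.coe_mul, ← eval_mulPolyGL, h]

/-- The inverse of an algebraic cocharacter is algebraic (`eval_invPolyGL`). [folklore] -/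
lemma IsAlgebraicCochar.inv {γ : kˣ →* ↥T} (hγ : IsAlgebraicCochar γ) :
    IsAlgebraicCochar γ⁻¹ := by
  obtain ⟨P, hP⟩ := hγ
  refine ⟨fun c => MvPolynomial.bind₁ P (invPolyGL c), fun x c => ?_⟩
  have h : glCoordFun ((γ x : ↥T) : GL n k) =
      fun i => MvPolynomial.eval ![(x : k), (x⁻¹ : kˣ)] (P i) := funext (hP x)
  rw [eval_bind₁, MonoidHom.inv_apply, Subgroup.coe_inv, ← eval_invPolyGL, h]

variable (T) in
/-- The *cocharacter lattice* `X_*(T)` of a commutative subgroup `T ≤ GL n k`: the group of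
algebraic homomorphisms `𝔾ₘ → T` (Springer 3.2.1). The group structure on `kˣ →* ↥T` uses the
scoped instance `CommGroup ↥T` from `[IsMulCommutative ↥T]` (OUTLINE §0 H2). [folklore] -/
def cocharacterLattice : Subgroup (kˣ →* ↥T) where
  carrier := {γ | IsAlgebraicCochar γ}
  one_mem' := IsAlgebraicCochar.one
  mul_mem' := IsAlgebraicCochar.mul
  inv_mem' := IsAlgebraicCochar.inv

/-- Membership in the cocharacter lattice (Springer 3.2.1). [folklore] -/
@[simp] lemma mem_cocharacterLattice_iff (γ : kˣ →* ↥T) :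
    γ ∈ cocharacterLattice T ↔ IsAlgebraicCochar γ := Iff.rfl

end Lattices

section Pairing

variable {T : Subgroup (GL n k)}

open Classical in
/-- The pairing `⟨χ, λ⟩ ∈ ℤ` of a character `χ : T → 𝔾ₘ` and a cocharacter `λ : 𝔾ₘ → T`: the
integer `m` such that `χ (λ x) = x ^ m` for all `x ∈ kˣ` (Springer 3.2.11 (i)). **Junk value**
(OUTLINE D8): if no such `m` exists the value is `0`; if several exist (possible only over a finite
field) an unspecified one is chosen. For algebraic `χ, λ` over an infinite field `m` exists and is
unique (`exists_unique_charPairing`), and `charPairingInt_spec` holds. [folklore] -/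
noncomputable def charPairingInt (χ : ↥T →* kˣ) (γ : kˣ →* ↥T) : ℤ :=
  if h : ∃ m : ℤ, χ.comp γ = zpowGroupHom m then h.choose else 0

/-- Over an infinite field, the composite of an algebraic character and an algebraic cocharacter is
`x ↦ x ^ m` for a unique integer `m` (Springer 3.2.11 (i) with 3.2.1: algebraic endomorphisms of
`𝔾ₘ` are the maps `x ↦ x ^ m`; a multiplicative Laurent polynomial is a monomial). [cite: SpringerLAG1998, 3.2.11(i) and 3.2.1] -/
def exists_unique_charPairing : Prop :=
  ∀ [Infinite k] {χ : ↥T →* kˣ} {γ : kˣ →* ↥T} (hχ : IsAlgebraicChar χ) (hγ : IsAlgebraicCochar γ),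
    ∃! m : ℤ, χ.comp γ = zpowGroupHom m

/-- Defining property of `charPairingInt` for algebraic `χ, λ` over an infinite field:
`χ (λ x) = x ^ ⟨χ, λ⟩` (Springer 3.2.11 (i)). [folklore] -/
def charPairingInt_spec : Prop :=
  ∀ [Infinite k] {χ : ↥T →* kˣ} {γ : kˣ →* ↥T} (hχ : IsAlgebraicChar χ) (hγ : IsAlgebraicCochar γ) (x : kˣ),
    χ (γ x) = x ^ charPairingInt χ γ

/- interim proof relied on results that are now named facts (D-0014); demoted to a fact by the M5 import, proof preserved:
:= by
  obtain ⟨m, hm, -⟩ := exists_unique_charPairing hχ hγ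
  have h : ∃ m : ℤ, χ.comp γ = zpowGroupHom m := ⟨m, hm⟩
  have hspec := h.choose_spec
  rw [charPairingInt, dif_pos h]
  exact DFunLike.congr_fun hspec x
-/

end Pairing

/-! ### The diagonal torus -/

/-- The diagonal embedding `(kˣ)ⁿ →* GL n k`, `d ↦ diag (d₁, …, dₙ)` (Springer 3.2.1, the torus
`𝔻ₙ`). Built from Mathlib's `Matrix.diagonalRingHom` and `MulEquiv.piUnits`. [folklore] -/
def diagonalGL (n k : Type*) [Field k] [Fintype n] [DecidableEq n] : (n → kˣ) →* GL n k :=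
  (Units.map (Matrix.diagonalRingHom n k).toMonoidHom).comp
    (MulEquiv.piUnits (M := fun _ : n => k)).symm.toMonoidHom

/-- The matrix underlying `diagonalGL n k d` is `diag d` (Springer 3.2.1). [folklore] -/
@[simp] lemma coe_diagonalGL (d : n → kˣ) :
    (diagonalGL n k d : Matrix n n k) = Matrix.diagonal fun i => (d i : k) := rfl

/-- The diagonal torus `𝔻ₙ ≤ GL n k` of invertible diagonal matrices (Springer 3.2.1). [folklore] -/
def diagonalSubgroup (n k : Type*) [Field k] [Fintype n] [DecidableEq n] : Subgroup (GL n k) := (diagonalGL n k).range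

/-- Over an algebraically closed field the diagonal subgroup `𝔻ₙ ≤ GL n k` is a torus in the sense
of `IsTorusSubgroup` (Springer 3.2.1, 2.2.1: `𝔻ₙ ≅ 𝔾ₘⁿ` is a connected closed commutative
subgroup of semisimple elements). [cite: SpringerLAG1998, 3.2.1 and 2.2.1] -/
def isTorusSubgroup_diagonal : Prop :=
  ∀ [IsAlgClosed k],
    IsTorusSubgroup (diagonalSubgroup n k)

end Literature.NumberTheory.Automorphic
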